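import Summits.ValiantsHypothesis.ValiantsHypothesis.Theorems.KPlusLogSqLawTropicalBValuedBlocks
import Summits.ValiantsHypothesis.ValiantsHypothesis.Theorems.KPlusLogSqLawTropicalClassMonotone

/-!
# Route `KPlusLogSqLaw`, crux `TropicalB` (stmt-ValiantsHypothesis-19771) — TWO PRESENT ROWS PER COLUMN ARE LINEAR, for any number of
# classes per entry: `n ≤ 2·K·m + m`

HONEST FRAMING.  Helper file (seat val-sym-trop-p1 g14, cell `pub-symmetroid`, 2026-08-28) toward the registered stubs
`stub_tropThin` / `stub_tropFat` of `Cruxes/TropicalB/Lines/birth.lean` (crux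
`Summit.ValiantsHypothesis.ValiantsHypothesis.Theses.KPlusLogSqLaw.TropicalB`, item `stmt-ValiantsHypothesis-19771`, route
`KPlusLogSqLaw`; `--supports … --as helper`).  Sequel of `…TropicalBTwoPermutations` (p591144: the STATIC case, one class per entry,
`n ≤ m`) and `…TropicalBValuedBlocks` (p591427).  A SECTOR law valid for every `K`, all exponents and valuations; it bounds nothing for
`TropicalB` in its window and bears on neither `WeakLifting`, DoorA26/DoorA34, `MatrixDescartes` (stmt-ValiantsHypothesis-18050) nor
VP ≠ VNP.

THE LAW.  If every column of a design has at most two PRESENT ROWS — every present `(entry, class)` incidence lies on `(σ₀ j, j)` or on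
`(σ₁ j, j)` for two permutations `σ₀, σ₁`, with ANY set of classes on each of these entries — then every dominant chain at strictly
increasing integer slopes with pairwise distinct consecutive terms has

  **`n ≤ 2·K·m + m`**   (`chain_le_linear`; census form `designRowD_of_twoRows : DesignRowD d v ε (2·K·m + m)`).

Proof: on each orbit `C` of `ρ = σ₀⁻¹σ₁` a present term follows `σ₀` on all of `C` or `σ₁` on all of `C` (`option_of_support`, the
all-or-nothing lemma of the static file without its class hypothesis); along the chain the terms following a FIXED option on `C` use the
same entries there, so by per-entry class monotonicity (`TropicalCensus.d_lt_of_isDominant_of_sameEntry`) their class vectors strictly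
increase in the rank potential `Σ_{j∈C} #{l' : d l' < d (class j)} ≤ |C|·K`; hence at most `2·(|C|·K + 1)` restriction values occur on
`C` (`card_values_le`), the orbit is a valued block with chain-constant image (`TwoPermutations.image_eq_of_support`), and the
VALUED-BLOCK LAW (`ValuedBlocks.chain_le_sum_values`) over the orbit partition gives `n ≤ Σ_C (2|C|K + 1) = 2Km + #orbits ≤ 2Km + m`.
So «one binary choice of ROW per column» stays additive however many slope classes each of the two entries carries: the classes add at
most `2K` switches per column.  [folklore]-level (exchange principle + class monotonicity + orbit bookkeeping).
-/

set_option linter.dupNamespace false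
set_option autoImplicit false

namespace Summit.ValiantsHypothesis.ValiantsHypothesis.Theorems.KPlusLogSqLaw

open Summit.ValiantsHypothesis.ValiantsHypothesis.Theorems.MatrixDescartes.Negative
open Summit.ValiantsHypothesis.ValiantsHypothesis.Theorems.LacunarySymmetroidMatrixDescartes
open scoped BigOperators
open Finset IntervalOpt

namespace TwoRowsPerColumn

variable {m K : ℕ} {d : Fin K → ℕ} {v ε : Fin m → Fin m → Fin K → ℤ}

/-! ## 1. All or nothing on an orbit (no class hypothesis) -/

/-- On a minimal `ρ`-stable column set (`ρ = σ₀⁻¹σ₁`) a present term of a design supported on the rows of `σ₀, σ₁` follows `σ₀`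
everywhere or `σ₁` everywhere. [folklore] -/
theorem option_of_support (σ₀ σ₁ : Equiv.Perm (Fin m)) (hsupp : ∀ i j l, ε i j l ≠ 0 → i = σ₀ j ∨ i = σ₁ j)
    {C : Finset (Fin m)} (hC : ∀ j, j ∈ C ↔ (σ₀⁻¹ * σ₁) j ∈ C)
    (hmin : ∀ S : Finset (Fin m), S ⊆ C → (∀ j, j ∈ S ↔ (σ₀⁻¹ * σ₁) j ∈ S) → S = ∅ ∨ S = C)
    {p : Equiv.Perm (Fin m) × (Fin m → Fin K)} (hp : termSign ε p ≠ 0) :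
    (∀ j ∈ C, p.1 j = σ₀ j) ∨ (∀ j ∈ C, p.1 j = σ₁ j) := by
  classical
  set ρ : Equiv.Perm (Fin m) := σ₀⁻¹ * σ₁ with hρ
  have hpres := (termSign_ne_zero_iff ε p).1 hp
  have hρj : ∀ j, σ₀ (ρ j) = σ₁ j := fun j => by
    rw [hρ, Equiv.Perm.mul_apply]
    exact σ₀.apply_symm_apply _
  have hopt : ∀ j, p.1 j = σ₀ j ∨ p.1 j = σ₁ j := fun j => hsupp _ _ _ (hpres j)
  by_cases hfix : ∃ j ∈ C, ρ j = j
  · obtain ⟨j, hjC, hj⟩ := hfix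
    have hsing : ({j} : Finset (Fin m)) = C := by
      rcases hmin {j} (Finset.singleton_subset_iff.2 hjC) (fun j' => by
        rw [Finset.mem_singleton, Finset.mem_singleton]
        constructor
        · intro h; rw [h, hj]
        · intro h; exact ρ.injective (h.trans hj.symm)) with h | h
      · exact absurd h (Finset.singleton_ne_empty j)
      · exact h
    rcases hopt j with h | h
    · left; intro i hi; rw [← hsing, Finset.mem_singleton] at hi; subst hi; exact h
    · right; intro i hi; rw [← hsing, Finset.mem_singleton] at hi; subst hi; exact h
  · push Not at hfix
    have hne01 : ∀ j ∈ C, σ₁ j ≠ σ₀ j := by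
      intro j hj h
      apply hfix j hj
      apply σ₀.injective
      rw [hρj j, h]
    set S : Finset (Fin m) := C.filter fun j => p.1 j = σ₁ j with hS
    have hSsub : S ⊆ C := Finset.filter_subset _ _
    have hfwd : ∀ j, j ∈ S → ρ j ∈ S := by
      intro j hj
      rw [hS, Finset.mem_filter] at hj ⊢
      refine ⟨(hC j).1 hj.1, ?_⟩
      rcases hopt (ρ j) with h | h
      · exfalso
        have : ρ j = j := p.1.injective (by rw [h, hρj j, hj.2])
        exact hfix j hj.1 this
      · exact h
    have hbwd : ∀ j, ρ j ∈ S → j ∈ S := by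
      intro j hj
      rw [hS, Finset.mem_filter] at hj ⊢
      have hjC : j ∈ C := (hC j).2 hj.1
      refine ⟨hjC, ?_⟩
      obtain ⟨j'', hj''⟩ := p.1.surjective (σ₀ (ρ j))
      rcases hopt j'' with h | h
      · have e : j'' = ρ j := σ₀.injective (h ▸ hj'')
        subst e
        exact absurd (hj.2.symm.trans hj'') (hne01 _ hj.1)
      · have e : j'' = j := σ₁.injective (by rw [← h, hj'', hρj j])
        subst e
        rw [hj'', hρj]
    rcases hmin S hSsub (fun j => ⟨hfwd j, hbwd j⟩) with h0 | h1
    · left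
      intro i hi
      rcases hopt i with h | h
      · exact h
      · exfalso
        have : i ∈ S := by rw [hS, Finset.mem_filter]; exact ⟨hi, h⟩
        rw [h0] at this
        exact absurd this (Finset.notMem_empty i)
    · right
      intro i hi
      have : i ∈ S := h1 ▸ hi
      rw [hS, Finset.mem_filter] at this
      exact this.2

/-! ## 2. The rank potential and the value count on an orbit -/

/-- the rank `#{l' : d l' < d l}` of a class is less than `K`. [folklore] -/
theorem rank_lt (d : Fin K → ℕ) (l : Fin K) : (Finset.univ.filter fun l' : Fin K => d l' < d l).card < K := by
  calc (Finset.univ.filter fun l' : Fin K => d l' < d l).card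
      < (Finset.univ : Finset (Fin K)).card := by
        apply Finset.card_lt_card
        refine Finset.filter_ssubset.2 ⟨l, Finset.mem_univ l, lt_irrefl _⟩
    _ = K := by simp

/-- the rank is strictly monotone in the exponent. [folklore] -/
theorem rank_lt_rank {d : Fin K → ℕ} {l l' : Fin K} (h : d l < d l') :
    (Finset.univ.filter fun x : Fin K => d x < d l).card < (Finset.univ.filter fun x : Fin K => d x < d l').card := by
  apply Finset.card_lt_card
  rw [Finset.ssubset_iff_of_subset]
  · exact ⟨l, by simp [h], by simp⟩
  · intro x hx
    rw [Finset.mem_filter] at hx ⊢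
    exact ⟨hx.1, hx.2.trans h⟩

/-- **Class vectors rise on a fixed option.**  Two dominant terms at slopes `θ₁ < θ₂` using the SAME rows on `C` but with different
restrictions there have strictly increasing rank potential `Σ_{j ∈ C} #{l' : d l' < d (class j)}` (per-entry class monotonicity,
summed over `C`). [folklore] -/
theorem pot_lt_of_sameRows {θ₁ θ₂ : ℤ} (hθ : θ₁ < θ₂) {p₁ p₂ : Equiv.Perm (Fin m) × (Fin m → Fin K)}
    (h₁ : IsDominant d v ε θ₁ p₁) (h₂ : IsDominant d v ε θ₂ p₂) {C : Finset (Fin m)}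
    (hrows : ∀ j ∈ C, p₁.1 j = p₂.1 j) (hne : restr C p₁ ≠ restr C p₂) :
    ∑ j ∈ C, (Finset.univ.filter fun x : Fin K => d x < d (p₁.2 j)).card <
      ∑ j ∈ C, (Finset.univ.filter fun x : Fin K => d x < d (p₂.2 j)).card := by
  have hle : ∀ j ∈ C, (Finset.univ.filter fun x : Fin K => d x < d (p₁.2 j)).card ≤
      (Finset.univ.filter fun x : Fin K => d x < d (p₂.2 j)).card := by
    intro j hj
    by_cases hc : p₁.2 j = p₂.2 j
    · rw [hc]
    · exact (rank_lt_rank (TropicalCensus.d_lt_of_isDominant_of_sameEntry d v ε hθ h₁ h₂ j (hrows j hj) hc)).le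
  have hlt : ∃ j ∈ C, (Finset.univ.filter fun x : Fin K => d x < d (p₁.2 j)).card <
      (Finset.univ.filter fun x : Fin K => d x < d (p₂.2 j)).card := by
    by_contra hall
    push Not at hall
    apply hne
    refine restr_eq_iff.2 fun j hj => ⟨hrows j hj, ?_⟩
    by_contra hc
    exact absurd (rank_lt_rank (TropicalCensus.d_lt_of_isDominant_of_sameEntry d v ε hθ h₁ h₂ j (hrows j hj) hc))
      (not_lt.2 (hall j hj))
  exact Finset.sum_lt_sum hle hlt

/-- **At most `|C|·K + 1` values per option.**  Along a dominant chain, the restriction values on `C` of the terms that follow a fixed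
permutation `τ` on `C` number at most `|C|·K + 1` (the rank potential is injective on them and bounded by `|C|·K`). [folklore] -/
theorem card_values_option_le {n : ℕ} {θ : Fin (n + 1) → ℤ} {p : Fin (n + 1) → Equiv.Perm (Fin m) × (Fin m → Fin K)}
    (hθ : StrictMono θ) (hdom : ∀ k, IsDominant d v ε (θ k) (p k)) (C : Finset (Fin m)) (τ : Equiv.Perm (Fin m)) :
    ((Finset.univ.filter fun k : Fin (n + 1) => ∀ j ∈ C, (p k).1 j = τ j).image fun k => restr C (p k)).card
      ≤ C.card * K + 1 := by
  classical
  set T := (Finset.univ.filter fun k : Fin (n + 1) => ∀ j ∈ C, (p k).1 j = τ j) with hT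
  -- the rank potential, read off a restriction value
  let f : (Fin m → Option (Fin m × Fin K)) → ℕ :=
    fun r => ∑ j ∈ C, (r j).elim 0 fun q => (Finset.univ.filter fun x : Fin K => d x < d q.2).card
  have hf : ∀ q : Equiv.Perm (Fin m) × (Fin m → Fin K),
      f (restr C q) = ∑ j ∈ C, (Finset.univ.filter fun x : Fin K => d x < d (q.2 j)).card := by
    intro q
    refine Finset.sum_congr rfl fun j hj => ?_
    rw [restr_apply_of_mem hj]
    rfl
  have hmaps : Set.MapsTo f ((T.image fun k => restr C (p k)) : Set _) (Finset.range (C.card * K + 1) : Set ℕ) := by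
    intro r hr
    rw [Finset.mem_coe, Finset.mem_image] at hr
    obtain ⟨k, -, rfl⟩ := hr
    rw [Finset.mem_coe, Finset.mem_range, hf]
    apply Nat.lt_succ_of_le
    calc ∑ j ∈ C, (Finset.univ.filter fun x : Fin K => d x < d ((p k).2 j)).card
        ≤ ∑ _j ∈ C, K := Finset.sum_le_sum fun j _ => (rank_lt d _).le
      _ = C.card * K := by rw [Finset.sum_const, smul_eq_mul]
  have hinj : Set.InjOn f ((T.image fun k => restr C (p k)) : Set _) := by
    intro r hr r' hr' h
    rw [Finset.mem_coe, Finset.mem_image] at hr hr'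
    obtain ⟨k, hk, rfl⟩ := hr
    obtain ⟨k', hk', rfl⟩ := hr'
    rw [hT, Finset.mem_filter] at hk hk'
    rw [hf, hf] at h
    by_contra hne
    have hrows : ∀ j ∈ C, (p k).1 j = (p k').1 j := fun j hj => (hk.2 j hj).trans (hk'.2 j hj).symm
    rcases lt_trichotomy k k' with hlt | heq | hgt
    · exact absurd h (pot_lt_of_sameRows (hθ hlt) (hdom k) (hdom k') hrows hne).ne
    · exact hne (by rw [heq])
    · have hrows' : ∀ j ∈ C, (p k').1 j = (p k).1 j := fun j hj => (hrows j hj).symm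
      exact absurd h.symm (pot_lt_of_sameRows (hθ hgt) (hdom k') (hdom k) hrows' (Ne.symm hne)).ne
  have := Finset.card_le_card_of_injOn f hmaps hinj
  simpa using this

/-- **At most `2(|C|·K + 1)` values on an orbit.**  For a design supported on the rows of `σ₀, σ₁` and a minimal `ρ`-stable `C`, the
restriction values of a dominant chain on `C` number at most `2·(|C|·K + 1)`. [folklore] -/
theorem card_values_le (σ₀ σ₁ : Equiv.Perm (Fin m)) (hsupp : ∀ i j l, ε i j l ≠ 0 → i = σ₀ j ∨ i = σ₁ j)
    {C : Finset (Fin m)} (hC : ∀ j, j ∈ C ↔ (σ₀⁻¹ * σ₁) j ∈ C)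
    (hmin : ∀ S : Finset (Fin m), S ⊆ C → (∀ j, j ∈ S ↔ (σ₀⁻¹ * σ₁) j ∈ S) → S = ∅ ∨ S = C)
    {n : ℕ} {θ : Fin (n + 1) → ℤ} {p : Fin (n + 1) → Equiv.Perm (Fin m) × (Fin m → Fin K)}
    (hθ : StrictMono θ) (hdom : ∀ k, IsDominant d v ε (θ k) (p k)) :
    (Finset.univ.image fun k : Fin (n + 1) => restr C (p k)).card ≤ 2 * (C.card * K + 1) := by
  classical
  have hsub : (Finset.univ.image fun k : Fin (n + 1) => restr C (p k)) ⊆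
      ((Finset.univ.filter fun k : Fin (n + 1) => ∀ j ∈ C, (p k).1 j = σ₀ j).image fun k => restr C (p k)) ∪
      ((Finset.univ.filter fun k : Fin (n + 1) => ∀ j ∈ C, (p k).1 j = σ₁ j).image fun k => restr C (p k)) := by
    intro r hr
    rw [Finset.mem_image] at hr
    obtain ⟨k, -, rfl⟩ := hr
    rw [Finset.mem_union, Finset.mem_image, Finset.mem_image]
    rcases option_of_support σ₀ σ₁ hsupp hC hmin (hdom k).1 with h | h
    · exact Or.inl ⟨k, by rw [Finset.mem_filter]; exact ⟨Finset.mem_univ k, h⟩, rfl⟩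
    · exact Or.inr ⟨k, by rw [Finset.mem_filter]; exact ⟨Finset.mem_univ k, h⟩, rfl⟩
  calc (Finset.univ.image fun k : Fin (n + 1) => restr C (p k)).card
      ≤ _ := Finset.card_le_card hsub
    _ ≤ _ := Finset.card_union_le _ _
    _ ≤ (C.card * K + 1) + (C.card * K + 1) :=
        Nat.add_le_add (card_values_option_le hθ hdom C σ₀) (card_values_option_le hθ hdom C σ₁)
    _ = 2 * (C.card * K + 1) := by ring

/-! ## 3. The orbit partition and the linear bound -/

/-- **TWO PRESENT ROWS PER COLUMN ARE LINEAR.**  If every present `(entry, class)` incidence of a design of format `(m, K)` lies on the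
row `σ₀ j` or `σ₁ j` of its column `j` (any classes, exponents, valuations), then every dominant chain at strictly increasing integer
slopes with pairwise distinct consecutive terms has `n ≤ 2·K·m + m`. [folklore] -/
theorem chain_le_linear (σ₀ σ₁ : Equiv.Perm (Fin m)) (hsupp : ∀ i j l, ε i j l ≠ 0 → i = σ₀ j ∨ i = σ₁ j)
    {n : ℕ} {θ : Fin (n + 1) → ℤ} {p : Fin (n + 1) → Equiv.Perm (Fin m) × (Fin m → Fin K)}
    (hθ : StrictMono θ) (hdom : ∀ k, IsDominant d v ε (θ k) (p k)) (hstep : ∀ k : Fin n, p k.castSucc ≠ p k.succ) :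
    n ≤ 2 * K * m + m := by
  classical
  set ρ : Equiv.Perm (Fin m) := σ₀⁻¹ * σ₁ with hρ
  -- orbits of `ρ`
  let orb : Fin m → Finset (Fin m) := fun t => Finset.univ.filter fun j => ρ.SameCycle t j
  have hmem : ∀ t j, j ∈ orb t ↔ ρ.SameCycle t j := fun t j => by
    simp only [orb, Finset.mem_filter, Finset.mem_univ, true_and]
  have hstab : ∀ t j, j ∈ orb t ↔ ρ j ∈ orb t := fun t j => by
    rw [hmem, hmem, Equiv.Perm.sameCycle_apply_right]
  have hpow_mem : ∀ (S : Finset (Fin m)), (∀ j, j ∈ S ↔ ρ j ∈ S) → ∀ j₀ ∈ S, ∀ i : ℕ, (ρ ^ i) j₀ ∈ S := by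
    intro S hS j₀ hj₀ i
    induction i with
    | zero => simpa using hj₀
    | succ i ih =>
      rw [pow_succ', Equiv.Perm.mul_apply]
      exact (hS _).1 ih
  have hmin : ∀ t (S : Finset (Fin m)), S ⊆ orb t → (∀ j, j ∈ S ↔ ρ j ∈ S) → S = ∅ ∨ S = orb t := by
    intro t S hS hst
    rcases S.eq_empty_or_nonempty with h | ⟨j₀, hj₀⟩
    · exact Or.inl h
    · right
      apply Finset.Subset.antisymm hS
      intro j hj
      have h2 : ρ.SameCycle j₀ j := ((hmem t j₀).1 (hS hj₀)).symm.trans ((hmem t j).1 hj)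
      obtain ⟨i, -, hi⟩ := h2.exists_pow_eq'
      rw [← hi]
      exact hpow_mem S hst j₀ hj₀ i
  have hself : ∀ t, t ∈ orb t := fun t => (hmem t t).2 (Equiv.Perm.SameCycle.refl ρ t)
  have horb_eq : ∀ t t', t' ∈ orb t → orb t' = orb t := by
    intro t t' ht'
    have h := (hmem t t').1 ht'
    ext j
    rw [hmem, hmem]
    exact ⟨fun hj => h.trans hj, fun hj => h.symm.trans hj⟩
  -- the set of orbits, indexed by `Fin g`
  set O : Finset (Finset (Fin m)) := Finset.univ.image orb with hO
  set g := O.card with hg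
  let e : Fin g ≃ {B // B ∈ O} := O.equivFin.symm
  let C : Fin g → Finset (Fin m) := fun t => (e t).1
  have hCorb : ∀ t, ∃ s, C t = orb s := fun t => by
    obtain ⟨s, -, hs⟩ := Finset.mem_image.1 (e t).2
    exact ⟨s, hs.symm⟩
  have hCstab : ∀ t j, j ∈ C t ↔ ρ j ∈ C t := fun t j => by
    obtain ⟨s, hs⟩ := hCorb t
    rw [hs]
    exact hstab s j
  have hCmin : ∀ t (S : Finset (Fin m)), S ⊆ C t → (∀ j, j ∈ S ↔ ρ j ∈ S) → S = ∅ ∨ S = C t := fun t => by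
    obtain ⟨s, hs⟩ := hCorb t
    rw [hs]
    exact hmin s
  -- the valued-block law over the orbits
  have himg : ∀ t k k', (C t).image (p k).1 = (C t).image (p k').1 := fun t k k' => by
    rw [TwoPermutations.image_eq_of_support σ₀ σ₁ hsupp (hCstab t) (hdom k).1,
      TwoPermutations.image_eq_of_support σ₀ σ₁ hsupp (hCstab t) (hdom k').1]
  have hcov : ∀ k : Fin n, ∃ t, restr (C t) (p k.castSucc) ≠ restr (C t) (p k.succ) := by
    intro k
    by_contra hall
    push Not at hall
    apply hstep k
    have hcols : ∀ j, (p k.castSucc).1 j = (p k.succ).1 j ∧ (p k.castSucc).2 j = (p k.succ).2 j := by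
      intro j
      have hjO : orb j ∈ O := Finset.mem_image_of_mem orb (Finset.mem_univ j)
      let t : Fin g := e.symm ⟨orb j, hjO⟩
      have hCt : C t = orb j := by
        show (e (e.symm ⟨orb j, hjO⟩)).1 = orb j
        rw [Equiv.apply_symm_apply]
      have h := hall t
      rw [hCt] at h
      exact restr_eq_iff.1 h j (hself j)
    exact Prod.ext (Equiv.ext fun j => (hcols j).1) (funext fun j => (hcols j).2)
  have hbound := ValuedBlocks.chain_le_sum_values hθ hdom C himg
    (fun t => Finset.univ.image fun k : Fin (n + 1) => restr (C t) (p k))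
    (fun t k => Finset.mem_image_of_mem _ (Finset.mem_univ k)) hcov
  -- per-orbit value counts
  have hterm : ∀ t, (Finset.univ.image fun k : Fin (n + 1) => restr (C t) (p k)).card - 1 ≤ 2 * K * (C t).card + 1 := by
    intro t
    have h := card_values_le σ₀ σ₁ hsupp (hCstab t) (hCmin t) hθ hdom
    have : 2 * ((C t).card * K + 1) = (2 * K * (C t).card + 1) + 1 := by ring
    omega
  -- the orbits partition the columns
  have hdisj : (O : Set (Finset (Fin m))).PairwiseDisjoint id := by
    intro B hB B' hB' hne
    rw [Finset.mem_coe, hO, Finset.mem_image] at hB hB'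
    obtain ⟨s, -, rfl⟩ := hB
    obtain ⟨s', -, rfl⟩ := hB'
    rw [Function.onFun, Finset.disjoint_left]
    intro j hj hj'
    exact hne ((horb_eq s j hj).symm.trans (horb_eq s' j hj'))
  have hunion : O.biUnion id = Finset.univ := by
    apply Finset.eq_univ_of_forall
    intro j
    rw [Finset.mem_biUnion]
    exact ⟨orb j, Finset.mem_image_of_mem orb (Finset.mem_univ j), hself j⟩
  have hsumO : ∑ B ∈ O, B.card = m := by
    have h := Finset.card_biUnion hdisj
    rw [hunion, Finset.card_univ, Fintype.card_fin] at h
    simpa using h.symm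
  have hsumC : ∑ t, (C t).card = m := by
    have h1 : ∑ t, (C t).card = ∑ x : {B // B ∈ O}, x.1.card :=
      Fintype.sum_equiv e (fun t => (C t).card) (fun x => x.1.card) (fun t => rfl)
    rw [h1, Finset.sum_coe_sort O (fun B => B.card)]
    exact hsumO
  have hg_le : g ≤ m := by
    rw [hg, hO]
    exact (Finset.card_image_le).trans (by simp)
  calc n ≤ ∑ t, ((Finset.univ.image fun k : Fin (n + 1) => restr (C t) (p k)).card - 1) := hbound
    _ ≤ ∑ t, (2 * K * (C t).card + 1) := Finset.sum_le_sum fun t _ => hterm t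
    _ = 2 * K * ∑ t, (C t).card + g := by
        rw [Finset.sum_add_distrib, Finset.mul_sum]
        simp [hg]
    _ = 2 * K * m + g := by rw [hsumC]
    _ ≤ 2 * K * m + m := Nat.add_le_add_left hg_le _

/-- **Signed form.**  The same bound for sign-alternating dominant chains (the tree's census convention). [folklore] -/
theorem chain_le_linear_signed (σ₀ σ₁ : Equiv.Perm (Fin m)) (hsupp : ∀ i j l, ε i j l ≠ 0 → i = σ₀ j ∨ i = σ₁ j)
    {n : ℕ} {θ : Fin (n + 1) → ℤ} {p : Fin (n + 1) → Equiv.Perm (Fin m) × (Fin m → Fin K)}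
    (hθ : StrictMono θ) (hdom : ∀ k, IsDominant d v ε (θ k) (p k))
    (halt : ∀ k : Fin n, termSign ε (p k.castSucc) * termSign ε (p k.succ) < 0) : n ≤ 2 * K * m + m := by
  have hstep : ∀ k : Fin n, p k.castSucc ≠ p k.succ := by
    intro k h
    have := halt k
    rw [h] at this
    exact absurd this (not_lt.2 (mul_self_nonneg _))
  exact chain_le_linear σ₀ σ₁ hsupp hθ hdom hstep

/-- **Census currency.**  A design with at most two present rows per column has the unsigned row bound `2·K·m + m`. [folklore] -/
theorem designRowD_of_twoRows (σ₀ σ₁ : Equiv.Perm (Fin m)) (hsupp : ∀ i j l, ε i j l ≠ 0 → i = σ₀ j ∨ i = σ₁ j) :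
    DesignRowD d v ε (2 * K * m + m) :=
  fun _ _ _ hθ hdom hstep => chain_le_linear σ₀ σ₁ hsupp hθ hdom hstep

end TwoRowsPerColumn

end Summit.ValiantsHypothesis.ValiantsHypothesis.Theorems.KPlusLogSqLaw
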